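import Summits.RiemannHypothesis.RiemannHypothesis.Theorems.IntegerScrewCensusFastArith
import Literature.Analysis.ValidatedNumerics.MultiPrecisionBall

/-!
# Route `IntegerScrew` — fast kernel arithmetic for manifest-certificate checks (2): exact Taylor `cos` / `sin`

`cosFix cs A`, `sinFix cs A neg`, `cosSinFix` — `⌊2^52·T_c(A/2^52)⌋`, `⌊±2^52·T_s(A/2^52)⌋` (offset-encoded)
for the degree-16/17 Taylor polynomials of `cos`/`sin`, evaluated EXACTLY in `ℕ` from the coefficient list
`tcList = [17!/j!·2^{52(17−j)}]_{j ≤ 17}` with ONE final division (`TD = 17!·2^{52·16}`); semantics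
`trigSums_cos/sin`, and with the tree's `cos_sin_taylor_remainder` (`|x| ≤ 1`, 9 terms) the error bounds
`cosFix_err`, `sinFix_err_false/true`: within `2` ulps of `2^52 cos(A/2^52)`, `2^52 sin(±A/2^52)` for
`A ≤ 2^52`.  Pure arithmetic, RH-free and ζ-free; nothing here bears on the truth of RH.
-/

set_option linter.dupNamespace false
set_option autoImplicit false

namespace Summit.RiemannHypothesis.RiemannHypothesis.Theorems.IntegerScrew.Manifest.Fast

open Finset

/-! ### Exact Taylor polynomials of `cos`, `sin` in `ℕ`, one rounding -/

/-- Taylor coefficient scaled to an integer: `tc j = 17!/j! · 2^{52(17−j)}` (`j ≤ 17`). -/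
def tc (j : ℕ) : ℕ := Nat.factorial 17 / Nat.factorial j * SCL ^ (17 - j)

/-- The coefficient list `[tc 0, …, tc 17]` (evaluated once per kernel run and passed down). -/
def tcList : List ℕ :=
  [tc 0, tc 1, tc 2, tc 3, tc 4, tc 5, tc 6, tc 7, tc 8, tc 9, tc 10, tc 11, tc 12, tc 13, tc 14, tc 15,
    tc 16, tc 17]

/-- The common denominator `TD = 17! · 2^{52·16}`: `Σ_j ± tc j · A^j = TD · 2^52 · T(A/2^52)`. -/
def TD : ℕ := Nat.factorial 17 * SCL ^ 16

/-- The four partial sums `(P₀, P₁, P₂, P₃)`, `P_r = Σ_{j ≤ 17, j ≡ r (4)} c_j · A^j`, of a degree-17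
polynomial with coefficient list `[c₀, …, c₁₇]` (junk `0` for lists of another length). -/
def trigSums (cs : List ℕ) (A : ℕ) : ℕ × ℕ × ℕ × ℕ :=
  match cs with
  | [c0, c1, c2, c3, c4, c5, c6, c7, c8, c9, c10, c11, c12, c13, c14, c15, c16, c17] =>
    let A2 := A * A
    let A3 := A2 * A
    let A4 := A3 * A
    let A5 := A4 * A
    let A6 := A5 * A
    let A7 := A6 * A
    let A8 := A7 * A
    let A9 := A8 * A
    let A10 := A9 * A
    let A11 := A10 * A
    let A12 := A11 * A
    let A13 := A12 * A
    let A14 := A13 * A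
    let A15 := A14 * A
    let A16 := A15 * A
    let A17 := A16 * A
    (c0 + c4 * A4 + c8 * A8 + c12 * A12 + c16 * A16,
      c1 * A + c5 * A5 + c9 * A9 + c13 * A13 + c17 * A17,
      c2 * A2 + c6 * A6 + c10 * A10 + c14 * A14,
      c3 * A3 + c7 * A7 + c11 * A11 + c15 * A15)
  | _ => (0, 0, 0, 0)

/-- `⌊2^52 · T_c(A/2^52)⌋ + OFF`, `T_c(x) = Σ_{l<9} (−1)^l x^{2l}/(2l)!`: `(P₀ + OFF·TD − P₂)/TD`. -/
def cosFix (cs : List ℕ) (A : ℕ) : ℕ :=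
  ((trigSums cs A).1 + OFF * TD - (trigSums cs A).2.2.1) / TD

/-- `⌊± 2^52 · T_s(A/2^52)⌋ + OFF`, `T_s(x) = Σ_{l<9} (−1)^l x^{2l+1}/(2l+1)!` (sign `−` when `neg`):
`(P₁ + OFF·TD − P₃)/TD` resp. `(P₃ + OFF·TD − P₁)/TD`. -/
def sinFix (cs : List ℕ) (A : ℕ) (neg : Bool) : ℕ :=
  cond neg (((trigSums cs A).2.2.2 + OFF * TD - (trigSums cs A).2.1) / TD)
    (((trigSums cs A).2.1 + OFF * TD - (trigSums cs A).2.2.2) / TD)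


/-- `(cosFix, sinFix)` sharing ONE evaluation of the polynomial sums (the form the checkers call). -/
def cosSinFix (cs : List ℕ) (A : ℕ) (neg : Bool) : ℕ × ℕ :=
  match trigSums cs A with
  | (p0, p1, p2, p3) =>
    ((p0 + OFF * TD - p2) / TD, cond neg ((p3 + OFF * TD - p1) / TD) ((p1 + OFF * TD - p3) / TD))

/-- `cosSinFix` agrees with `cosFix`. -/
theorem cosSinFix_fst (cs : List ℕ) (A : ℕ) (neg : Bool) : (cosSinFix cs A neg).1 = cosFix cs A := rfl

/-- `cosSinFix` agrees with `sinFix`. -/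
theorem cosSinFix_snd (cs : List ℕ) (A : ℕ) (neg : Bool) : (cosSinFix cs A neg).2 = sinFix cs A neg := rfl

/-! ### Semantics of the polynomial sums -/

/-- The even Taylor polynomial of `cos`, 9 terms. -/
noncomputable def Tc (x : ℝ) : ℝ := ∑ l ∈ range 9, (-1 : ℝ) ^ l * x ^ (2 * l) / (2 * l).factorial

/-- The odd Taylor polynomial of `sin`, 9 terms. -/
noncomputable def Ts (x : ℝ) : ℝ := ∑ l ∈ range 9, (-1 : ℝ) ^ l * x ^ (2 * l + 1) / (2 * l + 1).factorial

/-- `tc j · j! = 17! · 2^{52(17−j)}` (exact division). -/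
theorem tc_mul_factorial {j : ℕ} (hj : j ≤ 17) : tc j * Nat.factorial j = Nat.factorial 17 * SCL ^ (17 - j) := by
  unfold tc
  rw [mul_comm, ← mul_assoc, mul_comm (Nat.factorial j), Nat.div_mul_cancel (Nat.factorial_dvd_factorial hj)]

/-- The coefficient identity over `ℝ`: `tc j · j! = 17! · 2^{52(17−j)}`. -/
theorem tc_cast {j : ℕ} (hj : j ≤ 17) :
    (tc j : ℝ) * (Nat.factorial j : ℝ) = (Nat.factorial 17 : ℝ) * (SCL : ℝ) ^ (17 - j) := by
  exact_mod_cast tc_mul_factorial hj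

/-- One term: `tc j · A^j = 17! · SCL^17 · ((A/SCL)^j / j!)`. -/
theorem tc_term {j : ℕ} (hj : j ≤ 17) (A : ℝ) :
    (tc j : ℝ) * A ^ j = (Nat.factorial 17 : ℝ) * (SCL : ℝ) ^ 17 * ((A / SCL) ^ j / (Nat.factorial j)) := by
  have h := tc_cast hj
  have hS : (SCL : ℝ) ≠ 0 := by norm_num [SCL]
  have hj0 : (Nat.factorial j : ℝ) ≠ 0 := by positivity
  have hpow : (SCL : ℝ) ^ 17 = (SCL : ℝ) ^ (17 - j) * (SCL : ℝ) ^ j := by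
    rw [← pow_add, Nat.sub_add_cancel hj]
  rw [hpow, div_pow]
  field_simp
  linear_combination A ^ j * h

/-- `TD · SCL = 17! · SCL^17`. -/
theorem TD_mul_SCL : (TD : ℝ) * SCL = (Nat.factorial 17 : ℝ) * (SCL : ℝ) ^ 17 := by
  unfold TD; push_cast; ring

/-- **`P₀ − P₂ = TD · 2^52 · T_c(A/2^52)`.** -/
theorem trigSums_cos (A : ℕ) :
    ((trigSums tcList A).1 : ℝ) - ((trigSums tcList A).2.2.1 : ℝ) = (TD : ℝ) * SCL * Tc ((A : ℝ) / SCL) := by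
  have e0 := tc_term (j := 0) (by norm_num) (A : ℝ)
  have e2 := tc_term (j := 2) (by norm_num) (A : ℝ)
  have e4 := tc_term (j := 4) (by norm_num) (A : ℝ)
  have e6 := tc_term (j := 6) (by norm_num) (A : ℝ)
  have e8 := tc_term (j := 8) (by norm_num) (A : ℝ)
  have e10 := tc_term (j := 10) (by norm_num) (A : ℝ)
  have e12 := tc_term (j := 12) (by norm_num) (A : ℝ)
  have e14 := tc_term (j := 14) (by norm_num) (A : ℝ)
  have e16 := tc_term (j := 16) (by norm_num) (A : ℝ)
  rw [TD_mul_SCL]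
  unfold Tc
  simp only [trigSums, tcList, Finset.sum_range_succ, Finset.sum_range_zero, Nat.cast_add, Nat.cast_mul]
  simp only [Nat.factorial_zero, pow_zero, mul_one, Nat.cast_one, zero_add] at e0 ⊢
  linear_combination e0 - e2 + e4 - e6 + e8 - e10 + e12 - e14 + e16

/-- **`P₁ − P₃ = TD · 2^52 · T_s(A/2^52)`.** -/
theorem trigSums_sin (A : ℕ) :
    ((trigSums tcList A).2.1 : ℝ) - ((trigSums tcList A).2.2.2 : ℝ) = (TD : ℝ) * SCL * Ts ((A : ℝ) / SCL) := by
  have e1 := tc_term (j := 1) (by norm_num) (A : ℝ)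
  have e3 := tc_term (j := 3) (by norm_num) (A : ℝ)
  have e5 := tc_term (j := 5) (by norm_num) (A : ℝ)
  have e7 := tc_term (j := 7) (by norm_num) (A : ℝ)
  have e9 := tc_term (j := 9) (by norm_num) (A : ℝ)
  have e11 := tc_term (j := 11) (by norm_num) (A : ℝ)
  have e13 := tc_term (j := 13) (by norm_num) (A : ℝ)
  have e15 := tc_term (j := 15) (by norm_num) (A : ℝ)
  have e17 := tc_term (j := 17) (by norm_num) (A : ℝ)
  rw [TD_mul_SCL]
  unfold Ts
  simp only [trigSums, tcList, Finset.sum_range_succ, Finset.sum_range_zero, Nat.cast_add, Nat.cast_mul]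
  simp only [pow_one] at e1 ⊢
  linear_combination e1 - e3 + e5 - e7 + e9 - e11 + e13 - e15 + e17

/-! ### Rounding and truncation: the trig values are within 2 ulps -/

/-- `|T_c(x)| ≤ 9` on `|x| ≤ 1` (nine terms of modulus `≤ 1`). -/
theorem abs_Tc_le {x : ℝ} (hx : |x| ≤ 1) : |Tc x| ≤ 9 := by
  unfold Tc
  refine (Finset.abs_sum_le_sum_abs _ _).trans ?_
  have h : ∀ l ∈ range 9, |(-1 : ℝ) ^ l * x ^ (2 * l) / (2 * l).factorial| ≤ 1 := by
    intro l _
    rw [abs_div, abs_mul, abs_pow, abs_pow, abs_neg, abs_one, one_pow, one_mul, Nat.abs_cast]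
    have h1 : |x| ^ (2 * l) ≤ 1 := pow_le_one₀ (abs_nonneg x) hx
    have h2 : (1 : ℝ) ≤ (2 * l).factorial := by exact_mod_cast Nat.one_le_iff_ne_zero.2 (Nat.factorial_ne_zero _)
    exact (div_le_one (by linarith)).2 (h1.trans h2)
  calc ∑ l ∈ range 9, |(-1 : ℝ) ^ l * x ^ (2 * l) / (2 * l).factorial| ≤ ∑ l ∈ range 9, (1 : ℝ) :=
        Finset.sum_le_sum h
    _ = 9 := by simp

/-- `|T_s(x)| ≤ 9` on `|x| ≤ 1`. -/
theorem abs_Ts_le {x : ℝ} (hx : |x| ≤ 1) : |Ts x| ≤ 9 := by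
  unfold Ts
  refine (Finset.abs_sum_le_sum_abs _ _).trans ?_
  have h : ∀ l ∈ range 9, |(-1 : ℝ) ^ l * x ^ (2 * l + 1) / (2 * l + 1).factorial| ≤ 1 := by
    intro l _
    rw [abs_div, abs_mul, abs_pow, abs_pow, abs_neg, abs_one, one_pow, one_mul, Nat.abs_cast]
    have h1 : |x| ^ (2 * l + 1) ≤ 1 := pow_le_one₀ (abs_nonneg x) hx
    have h2 : (1 : ℝ) ≤ (2 * l + 1).factorial := by
      exact_mod_cast Nat.one_le_iff_ne_zero.2 (Nat.factorial_ne_zero _)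
    exact (div_le_one (by linarith)).2 (h1.trans h2)
  calc ∑ l ∈ range 9, |(-1 : ℝ) ^ l * x ^ (2 * l + 1) / (2 * l + 1).factorial| ≤ ∑ l ∈ range 9, (1 : ℝ) :=
        Finset.sum_le_sum h
    _ = 9 := by simp

/-- `TD > 0`. -/
theorem TD_pos : (0 : ℤ) < TD := by unfold TD SCL; positivity

/-- `|A/2^52| ≤ 1` for `A ≤ 2^52`. -/
theorem abs_div_SCL_le {A : ℕ} (hA : A ≤ SCL) : |(A : ℝ) / SCL| ≤ 1 := by
  have hS : (0 : ℝ) < SCL := by norm_num [SCL]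
  rw [abs_of_nonneg (div_nonneg (Nat.cast_nonneg A) hS.le), div_le_one hS]
  exact_mod_cast hA

/-- The numerical truncation constant: `2^52 · 19/(18!·18) ≤ 1`. -/
theorem SCL_mul_rem_le_one : (SCL : ℝ) * ((2 * 9 + 1) / ((2 * 9).factorial * (2 * 9))) ≤ 1 := by
  norm_num [SCL, Nat.factorial]

/-- **`cosFix` is within 2 ulps of `2^52 cos(A/2^52)`** (`A ≤ 2^52`). -/
theorem cosFix_err {A : ℕ} (hA : A ≤ SCL) :
    |(oval (cosFix tcList A) : ℝ) - SCL * Real.cos ((A : ℝ) / SCL)| ≤ 2 := by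
  have hx : |(A : ℝ) / SCL| ≤ 1 := abs_div_SCL_le hA
  have hid := trigSums_cos A
  have hS : (0 : ℝ) < SCL := by norm_num [SCL]
  have hTDr : (0 : ℝ) < TD := by exact_mod_cast TD_pos
  set P := trigSums tcList A with hP
  have habs : |((P.1 : ℝ) - (P.2.2.1 : ℝ))| ≤ 9 * ((TD : ℝ) * SCL) := by
    rw [hid, abs_mul, abs_of_pos (mul_pos hTDr hS)]
    nlinarith [abs_Tc_le hx, mul_pos hTDr hS]
  have hle : P.2.2.1 ≤ P.1 + OFF * TD := by
    have h1 : ((P.2.2.1 : ℕ) : ℝ) ≤ (P.1 : ℝ) + (OFF : ℝ) * TD := by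
      have h9 : (9 : ℝ) * SCL ≤ OFF := by norm_num [SCL, OFF]
      nlinarith [(abs_le.1 habs).1, hTDr]
    exact_mod_cast h1
  have hval : oval (cosFix tcList A) = ((P.1 : ℤ) - P.2.2.1) / (TD : ℤ) := by
    unfold cosFix oval
    rw [← hP, Int.natCast_div, Nat.cast_sub hle]
    push_cast
    rw [show (P.1 : ℤ) + OFF * TD - P.2.2.1 = (P.1 - P.2.2.1) + OFF * TD by ring,
      Int.add_mul_ediv_right _ _ TD_pos.ne']
    ring
  rw [hval]
  obtain ⟨hq1, hq2⟩ := Literature.Analysis.ValidatedNumerics.NumericsMP.int_fdiv_bounds ((P.1 : ℤ) - P.2.2.1) TD_pos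
  have hreal : ((((P.1 : ℤ) - P.2.2.1 : ℤ)) : ℝ) / ((TD : ℤ) : ℝ) = SCL * Tc ((A : ℝ) / SCL) := by
    push_cast
    rw [hid]
    field_simp
  rw [hreal] at hq1 hq2
  have htaylor := (Literature.Analysis.ValidatedNumerics.NumericsMP.FB.cos_sin_taylor_remainder hx
    (K := 9) (by norm_num)).1
  have hrem : |(Real.cos ((A : ℝ) / SCL) - Tc ((A : ℝ) / SCL)) * SCL| ≤ 1 := by
    have h18 : |(A : ℝ) / SCL| ^ (2 * 9) ≤ 1 := pow_le_one₀ (abs_nonneg _) hx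
    have hc : (0 : ℝ) ≤ (2 * 9 + 1) / ((2 * 9).factorial * (2 * 9)) := by positivity
    have h1 : |Real.cos ((A : ℝ) / SCL) - Tc ((A : ℝ) / SCL)| ≤ (2 * 9 + 1) / ((2 * 9).factorial * (2 * 9)) := by
      unfold Tc
      exact htaylor.trans (mul_le_of_le_one_left hc h18)
    rw [abs_mul, abs_of_pos hS]
    nlinarith [SCL_mul_rem_le_one, abs_nonneg (Real.cos ((A : ℝ) / SCL) - Tc ((A : ℝ) / SCL))]
  obtain ⟨hr1, hr2⟩ := abs_le.1 hrem
  rw [abs_le]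
  constructor <;> nlinarith [hr1, hr2, hq1, hq2]

/-- **`sinFix … false` is within 2 ulps of `2^52 sin(A/2^52)`** (`A ≤ 2^52`). -/
theorem sinFix_err_false {A : ℕ} (hA : A ≤ SCL) :
    |(oval (sinFix tcList A false) : ℝ) - SCL * Real.sin ((A : ℝ) / SCL)| ≤ 2 := by
  have hx : |(A : ℝ) / SCL| ≤ 1 := abs_div_SCL_le hA
  have hid := trigSums_sin A
  have hS : (0 : ℝ) < SCL := by norm_num [SCL]
  have hTDr : (0 : ℝ) < TD := by exact_mod_cast TD_pos
  set P := trigSums tcList A with hP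
  have habs : |((P.2.1 : ℝ) - (P.2.2.2 : ℝ))| ≤ 9 * ((TD : ℝ) * SCL) := by
    rw [hid, abs_mul, abs_of_pos (mul_pos hTDr hS)]
    nlinarith [abs_Ts_le hx, mul_pos hTDr hS]
  have hle : P.2.2.2 ≤ P.2.1 + OFF * TD := by
    have h1 : ((P.2.2.2 : ℕ) : ℝ) ≤ (P.2.1 : ℝ) + (OFF : ℝ) * TD := by
      have h9 : (9 : ℝ) * SCL ≤ OFF := by norm_num [SCL, OFF]
      nlinarith [(abs_le.1 habs).1, hTDr]
    exact_mod_cast h1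
  have hval : oval (sinFix tcList A false) = ((P.2.1 : ℤ) - P.2.2.2) / (TD : ℤ) := by
    unfold sinFix oval
    rw [← hP, cond_false, Int.natCast_div, Nat.cast_sub hle]
    push_cast
    rw [show (P.2.1 : ℤ) + OFF * TD - P.2.2.2 = (P.2.1 - P.2.2.2) + OFF * TD by ring,
      Int.add_mul_ediv_right _ _ TD_pos.ne']
    ring
  rw [hval]
  obtain ⟨hq1, hq2⟩ := Literature.Analysis.ValidatedNumerics.NumericsMP.int_fdiv_bounds ((P.2.1 : ℤ) - P.2.2.2) TD_pos
  have hreal : ((((P.2.1 : ℤ) - P.2.2.2 : ℤ)) : ℝ) / ((TD : ℤ) : ℝ) = SCL * Ts ((A : ℝ) / SCL) := by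
    push_cast
    rw [hid]
    field_simp
  rw [hreal] at hq1 hq2
  have htaylor := (Literature.Analysis.ValidatedNumerics.NumericsMP.FB.cos_sin_taylor_remainder hx
    (K := 9) (by norm_num)).2
  have hrem : |(Real.sin ((A : ℝ) / SCL) - Ts ((A : ℝ) / SCL)) * SCL| ≤ 1 := by
    have h18 : |(A : ℝ) / SCL| ^ (2 * 9) ≤ 1 := pow_le_one₀ (abs_nonneg _) hx
    have hc : (0 : ℝ) ≤ (2 * 9 + 1) / ((2 * 9).factorial * (2 * 9)) := by positivity
    have h1 : |Real.sin ((A : ℝ) / SCL) - Ts ((A : ℝ) / SCL)| ≤ (2 * 9 + 1) / ((2 * 9).factorial * (2 * 9)) := by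
      unfold Ts
      exact htaylor.trans (mul_le_of_le_one_left hc h18)
    rw [abs_mul, abs_of_pos hS]
    nlinarith [SCL_mul_rem_le_one, abs_nonneg (Real.sin ((A : ℝ) / SCL) - Ts ((A : ℝ) / SCL))]
  obtain ⟨hr1, hr2⟩ := abs_le.1 hrem
  rw [abs_le]
  constructor <;> nlinarith [hr1, hr2, hq1, hq2]

/-- **`sinFix … true` is within 2 ulps of `2^52 sin(−A/2^52) = −2^52 sin(A/2^52)`** (`A ≤ 2^52`). -/
theorem sinFix_err_true {A : ℕ} (hA : A ≤ SCL) :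
    |(oval (sinFix tcList A true) : ℝ) - SCL * Real.sin (-((A : ℝ) / SCL))| ≤ 2 := by
  have hx : |(A : ℝ) / SCL| ≤ 1 := abs_div_SCL_le hA
  have hid := trigSums_sin A
  have hS : (0 : ℝ) < SCL := by norm_num [SCL]
  have hTDr : (0 : ℝ) < TD := by exact_mod_cast TD_pos
  set P := trigSums tcList A with hP
  have habs : |((P.2.1 : ℝ) - (P.2.2.2 : ℝ))| ≤ 9 * ((TD : ℝ) * SCL) := by
    rw [hid, abs_mul, abs_of_pos (mul_pos hTDr hS)]
    nlinarith [abs_Ts_le hx, mul_pos hTDr hS]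
  have hle : P.2.1 ≤ P.2.2.2 + OFF * TD := by
    have h1 : ((P.2.1 : ℕ) : ℝ) ≤ (P.2.2.2 : ℝ) + (OFF : ℝ) * TD := by
      have h9 : (9 : ℝ) * SCL ≤ OFF := by norm_num [SCL, OFF]
      nlinarith [(abs_le.1 habs).2, hTDr]
    exact_mod_cast h1
  have hval : oval (sinFix tcList A true) = ((P.2.2.2 : ℤ) - P.2.1) / (TD : ℤ) := by
    unfold sinFix oval
    rw [← hP, cond_true, Int.natCast_div, Nat.cast_sub hle]
    push_cast
    rw [show (P.2.2.2 : ℤ) + OFF * TD - P.2.1 = (P.2.2.2 - P.2.1) + OFF * TD by ring,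
      Int.add_mul_ediv_right _ _ TD_pos.ne']
    ring
  rw [hval]
  obtain ⟨hq1, hq2⟩ := Literature.Analysis.ValidatedNumerics.NumericsMP.int_fdiv_bounds ((P.2.2.2 : ℤ) - P.2.1) TD_pos
  have hreal : ((((P.2.2.2 : ℤ) - P.2.1 : ℤ)) : ℝ) / ((TD : ℤ) : ℝ) = -(SCL * Ts ((A : ℝ) / SCL)) := by
    push_cast
    rw [show ((P.2.2.2 : ℝ) - (P.2.1 : ℝ)) = -(((P.2.1 : ℝ) - (P.2.2.2 : ℝ))) by ring, hid]
    field_simp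
  rw [hreal] at hq1 hq2
  have htaylor := (Literature.Analysis.ValidatedNumerics.NumericsMP.FB.cos_sin_taylor_remainder hx
    (K := 9) (by norm_num)).2
  have hrem : |(Real.sin ((A : ℝ) / SCL) - Ts ((A : ℝ) / SCL)) * SCL| ≤ 1 := by
    have h18 : |(A : ℝ) / SCL| ^ (2 * 9) ≤ 1 := pow_le_one₀ (abs_nonneg _) hx
    have hc : (0 : ℝ) ≤ (2 * 9 + 1) / ((2 * 9).factorial * (2 * 9)) := by positivity
    have h1 : |Real.sin ((A : ℝ) / SCL) - Ts ((A : ℝ) / SCL)| ≤ (2 * 9 + 1) / ((2 * 9).factorial * (2 * 9)) := by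
      unfold Ts
      exact htaylor.trans (mul_le_of_le_one_left hc h18)
    rw [abs_mul, abs_of_pos hS]
    nlinarith [SCL_mul_rem_le_one, abs_nonneg (Real.sin ((A : ℝ) / SCL) - Ts ((A : ℝ) / SCL))]
  obtain ⟨hr1, hr2⟩ := abs_le.1 hrem
  rw [Real.sin_neg, abs_le]
  constructor <;> nlinarith [hr1, hr2, hq1, hq2]

end Summit.RiemannHypothesis.RiemannHypothesis.Theorems.IntegerScrew.Manifest.Fast
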